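import Summits.BirchSwinnertonDyer.Rank1Residual.GaloisImage.LocalThreeTorsionTriplingDecider
import Literature.NumberTheory.EllipticCurves.VariableChangePointsMap
import Literature.NumberTheory.EllipticCurves.PointReduction
import Mathlib.NumberTheory.Padics.HeightOneSpectrum
import Mathlib.FieldTheory.IsAlgClosed.AlgebraicClosure
import HarnessLib

/-!
# The TRIPLING TEST `Σ-TRI`, part 3: the `σ = E0` datum in THEOREM B's own currency
# (`v₀.adicCompletionIntegers ℚ`, `AlgebraicClosure (v₀.adicCompletion ℚ)`) at the place `v₀ ∣ 3`
# (cell `b2b-bsdres`, team n1011, ROW T-SIG3-TRI = r1 ROUTE-1 §46.5 ST-46a′; seat p09 GEN 12)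

HONEST FRAMING (cell `b2b-bsdres`, run/shared/lean/b2b/bsd-rank1-residual/, verbatim in every
file): the goal of the cell is to DELETE the COMBINATION-SHAPED residual classes of the
Birch–Swinnerton-Dyer formula for ALL analytic-rank `≤ 1` elliptic curves over `ℚ` — "full BSD
formula for every rank `≤ 1` curve in class `C`" assembled STRICTLY from published theorems — so
that the rank-`≤ 1` remainder becomes exactly the CONSTRUCTION-SHAPED classes, which are TYPED
(missing-input `Prop`s), NOT attempted. This is not "finishing BSD". Team n1011 (N10/N11 = X4 ∧
`p = 3`, research route on the CONSTRUCTION-SHAPED class X4, §I N11). THIS FILE IS A TOOL: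
theorems only (no definition, no named fact, no `sorry`); it closes nothing by itself, books
nothing, moves no mark / label / count.

## What

p10's THEOREM B (FILE 8b `TwistedWitness.exists_sha_ne_zero_of_congr_of_identityComponent`)
takes, per curve `W = ⟨a₁,…,a₆⟩` at the place `v₀` of `3`, the binders
`(M) (C) (hC : C • W.baseChange ℚ_v₀ = M ⊗ ℚ_v₀) (x₀ y₀ a)
(hcusp : M mod 𝔪 = singularModel x₀ y₀ a a)
{a₀ b₀ : 𝒪_v₀} (hns₀) (hm) (h3 : (3 : ℤ) • (a₀, b₀) = 0 in M(K̄_v₀))`. This file supplies them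
from parts 1–2 (`sigmaTriCheck`, `exists_nonsingular_threeTorsion_of_sigmaTriCheck`, which live
over `ℤ₃ ⊂ ℚ₃`) by transport along Mathlib's `adicCompletionIntegers.padicIntEquiv` /
`adicCompletion.padicEquiv`, with `M := ⟨a₁,…,a₆⟩.map (Int.castRingHom 𝒪_v₀)` and `C := 1`:

* §1 `one_smul_baseChange_eq_map_intModel` — `hC` for `C = 1`;
* §2 the transport, in three steps: `nonsingular_residue_padicIntEquiv_symm` (residue fields,
  `IsLocalRing.ResidueField.map`), `exists_three_zsmul_eq_zero_padicIntEquiv_symm` (the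
  `ℚ_v₀`-point: `Affine.Point.map` along `padicEquiv` read as a `ℚ_p`-algebra structure on
  `ℚ_v₀`), `exists_three_zsmul_eq_zero_algebraicClosure` (`ℚ_v₀ → K̄_v₀`, p10's FILE 8c pattern);
  assembled in `identityComponent_datum_of_padicInt` (generic place `v₀` over `p`);
* §3 **`identityComponent_datum_of_sigmaTriCheck`** — record shape: `(W) [W.IsElliptic]
  (hW : W = ⟨a₁,…,a₆⟩) (v₀) (hv₀ : primesEquiv v₀ = 3) (h : sigmaTriCheck a₁ … a₆ = true)` ⊢
  `∃ a₀ b₀ hns₀ hm, (3 : ℤ) • some hm = 0`;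
* §4 `exists_map_residue_eq_singularModel_adicCompletion` — `hcusp` from the `ZMod 3` identity
  (`decide` per record);
* §5 pilot (r1 ST-46b's first row 2601h1): `cuspTriple_2601h1`, `identityComponent_datum_2601h1`,
  `exists_hcusp_2601h1` — the complete per-curve binder block of THEOREM B for one curve.

## References (provenance; nothing is cited as a fact)

* [SilvermanAEC2009] J. H. Silverman, *The Arithmetic of Elliptic Curves*, 2nd ed.: VII.2.
* r1 ROUTE-1 §46 (`cells/n1011/ROUTE-1.md`); p10 FILE 8b/8c binder lists (cell INBOX
  2026-08-22T01:42Z / 02:12Z; referee-1 GEN 39 ACK-1).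
-/

set_option autoImplicit false

noncomputable section

open scoped Classical NumberField
open WeierstrassCurve Literature.NumberTheory.EllipticCurves IsDedekindDomain NumberField
  Rat.HeightOneSpectrum

namespace Summit.BirchSwinnertonDyer.Rank1Residual.GaloisImage.SigmaTri

variable {v₀ : HeightOneSpectrum (𝓞 ℚ)}

/-! ### §1. `hC` with `C = 1` -/

/-- **`hC` for `C = 1`**: for `W = ⟨a₁,…,a₆⟩` (integer coefficients) the identity change of
variables carries `W ⊗ ℚ_v₀` to the base change of the integral model
`⟨a₁,…,a₆⟩.map (Int.castRingHom 𝒪_v₀)`. [folklore] -/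
theorem one_smul_baseChange_eq_map_intModel (a₁ a₂ a₃ a₄ a₆ : ℤ) (W : WeierstrassCurve ℚ)
    (hW : W = ⟨a₁, a₂, a₃, a₄, a₆⟩) :
    (1 : VariableChange (v₀.adicCompletion ℚ)) • W.baseChange (v₀.adicCompletion ℚ) =
      ((⟨a₁, a₂, a₃, a₄, a₆⟩ : WeierstrassCurve ℤ).map
          (Int.castRingHom (v₀.adicCompletionIntegers ℚ))).map
        (algebraMap (v₀.adicCompletionIntegers ℚ) (v₀.adicCompletion ℚ)) := by
  subst hW
  rw [one_smul]
  ext <;> simp [WeierstrassCurve.baseChange, WeierstrassCurve.map]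

/-! ### §2. Transport of the `σ = E0` datum from `ℤ_p ⊂ ℚ_p` to `𝒪_v₀ ⊂ ℚ_v₀ ⊂ K̄_v₀` -/

/-- **Step 1 — residue fields.** If `(ā, b̄)` is a nonsingular point of `V₀ mod p` over the
residue field of `ℤ_p` (`p` the prime under `v₀`), then the images of `a, b` under Mathlib's
`(adicCompletionIntegers.padicIntEquiv v₀).symm : ℤ_p ≃ 𝒪_v₀` reduce to a nonsingular point of
`V₀.map (Int.castRingHom 𝒪_v₀) mod 𝔪_v₀` (`IsLocalRing.ResidueField.map`, an injective field
map). The instance hypothesis `[Fact (Nat.Prime (primesEquiv v₀))]` is how Mathlib itself types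
`ℤ_[primesEquiv v₀]` (a local instance there); callers obtain it by `subst`. [folklore] -/
theorem nonsingular_residue_padicIntEquiv_symm [Fact (Nat.Prime (primesEquiv v₀ : ℕ))]
    (V₀ : WeierstrassCurve ℤ) {a b : ℤ_[(primesEquiv v₀ : ℕ)]}
    (hres : ((V₀.map (Int.castRingHom ℤ_[(primesEquiv v₀ : ℕ)])).map
        (IsLocalRing.residue ℤ_[(primesEquiv v₀ : ℕ)])).toAffine.Nonsingular
      (IsLocalRing.residue _ a) (IsLocalRing.residue _ b)) :
    ((V₀.map (Int.castRingHom (v₀.adicCompletionIntegers ℚ))).map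
        (IsLocalRing.residue (v₀.adicCompletionIntegers ℚ))).toAffine.Nonsingular
      (IsLocalRing.residue (v₀.adicCompletionIntegers ℚ)
        ((adicCompletionIntegers.padicIntEquiv v₀).symm a))
      (IsLocalRing.residue (v₀.adicCompletionIntegers ℚ)
        ((adicCompletionIntegers.padicIntEquiv v₀).symm b)) := by
  have hMres : (V₀.map (Int.castRingHom (v₀.adicCompletionIntegers ℚ))).map
      (IsLocalRing.residue (v₀.adicCompletionIntegers ℚ)) =
      ((V₀.map (Int.castRingHom ℤ_[(primesEquiv v₀ : ℕ)])).map (IsLocalRing.residue _)).map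
        (IsLocalRing.ResidueField.map
          ((adicCompletionIntegers.padicIntEquiv v₀).symm :
            ℤ_[(primesEquiv v₀ : ℕ)] →+* v₀.adicCompletionIntegers ℚ)) := by
    simp only [WeierstrassCurve.map_map]
    exact congrArg V₀.map (RingHom.ext_int _ _)
  rw [hMres]
  exact (Affine.map_nonsingular _ (RingHom.injective (IsLocalRing.ResidueField.map
    ((adicCompletionIntegers.padicIntEquiv v₀).symm :
      ℤ_[(primesEquiv v₀ : ℕ)] →+* v₀.adicCompletionIntegers ℚ))) _ _).mpr hres

/-- **Step 2 — the `ℚ_v₀`-point.** A `ℚ_p`-point `(a, b)` of `V₀` with `ℤ_p`-coordinates and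
`3 · (a, b) = O` maps, along Mathlib's `(adicCompletion.padicEquiv v₀).symm : ℚ_p ≃ ℚ_v₀`
(compatible with `padicIntEquiv`: `coe_padicIntEquiv_symm_apply`), to a `ℚ_v₀`-point of
`(V₀.map (Int.castRingHom 𝒪_v₀)) ⊗ ℚ_v₀` with `𝒪_v₀`-coordinates and `3 · = O` — transport of
points by `Affine.Point.map` for the `ℚ_p`-algebra structure on `ℚ_v₀` given by the isomorphism
itself. [folklore] -/
theorem exists_three_zsmul_eq_zero_padicIntEquiv_symm [Fact (Nat.Prime (primesEquiv v₀ : ℕ))]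
    (V₀ : WeierstrassCurve ℤ) {a b : ℤ_[(primesEquiv v₀ : ℕ)]}
    (hns : ((V₀.map (Int.castRingHom ℤ_[(primesEquiv v₀ : ℕ)])).baseChange
        ℚ_[(primesEquiv v₀ : ℕ)]).toAffine.Nonsingular
      (a : ℚ_[(primesEquiv v₀ : ℕ)]) (b : ℚ_[(primesEquiv v₀ : ℕ)]))
    (h3 : (3 : ℤ) • (Affine.Point.some _ _ hns) = 0) :
    ∃ hK : ((V₀.map (Int.castRingHom (v₀.adicCompletionIntegers ℚ))).map
        (algebraMap (v₀.adicCompletionIntegers ℚ) (v₀.adicCompletion ℚ))).toAffine.Nonsingular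
        (((adicCompletionIntegers.padicIntEquiv v₀).symm a : v₀.adicCompletionIntegers ℚ) :
          v₀.adicCompletion ℚ)
        (((adicCompletionIntegers.padicIntEquiv v₀).symm b : v₀.adicCompletionIntegers ℚ) :
          v₀.adicCompletion ℚ),
      (3 : ℤ) • (Affine.Point.some _ _ hK) = 0 := by
  have hφe : ∀ z : ℤ_[(primesEquiv v₀ : ℕ)],
      (adicCompletion.padicEquiv v₀).symm (z : ℚ_[(primesEquiv v₀ : ℕ)]) =
        (((adicCompletionIntegers.padicIntEquiv v₀).symm z : v₀.adicCompletionIntegers ℚ) :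
          v₀.adicCompletion ℚ) :=
    fun z => (adicCompletionIntegers.coe_padicIntEquiv_symm_apply v₀ z).symm
  have hMK : ((V₀.map (Int.castRingHom ℤ_[(primesEquiv v₀ : ℕ)])).baseChange
      ℚ_[(primesEquiv v₀ : ℕ)]).map
        ((adicCompletion.padicEquiv v₀).symm : ℚ_[(primesEquiv v₀ : ℕ)] →+* v₀.adicCompletion ℚ) =
      (V₀.map (Int.castRingHom (v₀.adicCompletionIntegers ℚ))).map
        (algebraMap (v₀.adicCompletionIntegers ℚ) (v₀.adicCompletion ℚ)) := by
    simp only [WeierstrassCurve.baseChange, WeierstrassCurve.map_map]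
    exact congrArg V₀.map (RingHom.ext_int _ _)
  have hKns : ((V₀.map (Int.castRingHom (v₀.adicCompletionIntegers ℚ))).map
      (algebraMap (v₀.adicCompletionIntegers ℚ) (v₀.adicCompletion ℚ))).toAffine.Nonsingular
      (((adicCompletionIntegers.padicIntEquiv v₀).symm a : v₀.adicCompletionIntegers ℚ) :
        v₀.adicCompletion ℚ)
      (((adicCompletionIntegers.padicIntEquiv v₀).symm b : v₀.adicCompletionIntegers ℚ) :
        v₀.adicCompletion ℚ) := by
    rw [← hMK, ← hφe, ← hφe]
    exact (Affine.map_nonsingular _ (RingHom.injective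
      ((adicCompletion.padicEquiv v₀).symm : ℚ_[(primesEquiv v₀ : ℕ)] →+* v₀.adicCompletion ℚ))
      _ _).mpr hns
  refine ⟨hKns, ?_⟩
  -- `Affine.Point.map` for the `ℚ_p`-algebra structure on `K_v₀` given by the isomorphism
  letI : Algebra ℚ_[(primesEquiv v₀ : ℕ)] (v₀.adicCompletion ℚ) :=
    ((adicCompletion.padicEquiv v₀).symm :
      ℚ_[(primesEquiv v₀ : ℕ)] →+* v₀.adicCompletion ℚ).toAlgebra
  have e₁ : ((V₀.map (Int.castRingHom ℤ_[(primesEquiv v₀ : ℕ)])).baseChange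
      ℚ_[(primesEquiv v₀ : ℕ)]).baseChange ℚ_[(primesEquiv v₀ : ℕ)] =
      (V₀.map (Int.castRingHom ℤ_[(primesEquiv v₀ : ℕ)])).baseChange ℚ_[(primesEquiv v₀ : ℕ)] := by
    rw [WeierstrassCurve.baseChange, Algebra.algebraMap_self, WeierstrassCurve.map_id]
  have e₂ : ((V₀.map (Int.castRingHom ℤ_[(primesEquiv v₀ : ℕ)])).baseChange
      ℚ_[(primesEquiv v₀ : ℕ)]).baseChange (v₀.adicCompletion ℚ) =
      (V₀.map (Int.castRingHom (v₀.adicCompletionIntegers ℚ))).map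
        (algebraMap (v₀.adicCompletionIntegers ℚ) (v₀.adicCompletion ℚ)) := by
    rw [WeierstrassCurve.baseChange, RingHom.algebraMap_toAlgebra]
    exact hMK
  set ψ := Affine.Point.map
    (W' := (V₀.map (Int.castRingHom ℤ_[(primesEquiv v₀ : ℕ)])).baseChange ℚ_[(primesEquiv v₀ : ℕ)])
    (Algebra.ofId ℚ_[(primesEquiv v₀ : ℕ)] (v₀.adicCompletion ℚ)) with hψ
  have hP : Affine.Point.congrEquiv e₂
      (ψ (Affine.Point.congrEquiv e₁.symm (Affine.Point.some _ _ hns))) =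
      Affine.Point.some _ _ hKns := by
    rw [Affine.Point.congrEquiv_some, hψ, Affine.Point.map_some, Affine.Point.congrEquiv_some]
    refine point_some_eq_some ?_ ?_
    · rw [Algebra.ofId_apply, RingHom.algebraMap_toAlgebra, RingHom.coe_coe]; exact hφe a
    · rw [Algebra.ofId_apply, RingHom.algebraMap_toAlgebra, RingHom.coe_coe]; exact hφe b
  rw [← hP, ← map_zsmul, ← map_zsmul, ← map_zsmul, h3, map_zero, map_zero, map_zero]

/-- **Step 3 — from `K` to `K̄`** (p10 FILE 8c pattern; any commutative ring `R` with an algebra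
map to a field `K`): a `K`-point `(a₀, b₀)` with `R`-coordinates and `3 · (a₀, b₀) = O` on
`M ⊗ K` reads, along the injective base change `K → K̄` (`Affine.Point.map (Algebra.ofId _ _)`),
as the binders `hm`, `h3` of THEOREM B. [folklore] -/
theorem exists_three_zsmul_eq_zero_algebraicClosure {R K : Type*} [CommRing R] [Field K]
    [Algebra R K] (M : WeierstrassCurve R) {a₀ b₀ : R}
    (hK : (M.map (algebraMap R K)).toAffine.Nonsingular (algebraMap R K a₀) (algebraMap R K b₀))
    (h3 : (3 : ℤ) • (Affine.Point.some _ _ hK) = 0) :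
    ∃ (hm : ((M.map (algebraMap R K)).baseChange (AlgebraicClosure K)).toAffine.Nonsingular
        (algebraMap R (AlgebraicClosure K) a₀) (algebraMap R (AlgebraicClosure K) b₀)),
      (3 : ℤ) • (Affine.Point.some _ _ hm) = 0 := by
  have hself : (M.map (algebraMap R K)).baseChange K = M.map (algebraMap R K) := by
    rw [WeierstrassCurve.baseChange, Algebra.algebraMap_self, WeierstrassCurve.map_id]
  set ι : ((M.map (algebraMap R K)).baseChange K).toAffine.Point →+
      ((M.map (algebraMap R K)).baseChange (AlgebraicClosure K)).toAffine.Point :=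
    WeierstrassCurve.Affine.Point.map (W' := M.map (algebraMap R K))
      (Algebra.ofId K (AlgebraicClosure K)) with hιdef
  have hm : ((M.map (algebraMap R K)).baseChange (AlgebraicClosure K)).toAffine.Nonsingular
      (algebraMap R (AlgebraicClosure K) a₀) (algebraMap R (AlgebraicClosure K) b₀) := by
    rw [IsScalarTower.algebraMap_apply R K (AlgebraicClosure K) a₀,
      IsScalarTower.algebraMap_apply R K (AlgebraicClosure K) b₀]
    exact (Affine.map_nonsingular (W := M.map (algebraMap R K))
      (f := algebraMap K (AlgebraicClosure K)) (RingHom.injective _) _ _).mpr hK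
  refine ⟨hm, ?_⟩
  have eP : (Affine.Point.some _ _ hm :
      ((M.map (algebraMap R K)).baseChange (AlgebraicClosure K)).toAffine.Point) =
      ι (Affine.Point.congrEquiv hself.symm (Affine.Point.some _ _ hK)) := by
    rw [Affine.Point.congrEquiv_some, hιdef, Affine.Point.map_some]
    exact point_some_eq_some (IsScalarTower.algebraMap_apply R K _ a₀)
      (IsScalarTower.algebraMap_apply R K _ b₀)
  rw [eP, ← map_zsmul, ← map_zsmul, h3, map_zero, map_zero]

/-- **The identity-component datum in THEOREM B's currency, from a `ℚ_p`-point** (steps 1–3):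
at a place `v₀` over `p`, a `ℚ_p`-rational point `(a, b)` of `V₀` with `ℤ_p`-coordinates,
NONSINGULAR reduction and `3 · (a, b) = O` yields `a₀, b₀ ∈ 𝒪_v₀` with nonsingular reduction on
`M = V₀.map (Int.castRingHom 𝒪_v₀)` and `3 · (a₀, b₀) = O` in `M(K̄_v₀)`. [folklore] -/
theorem identityComponent_datum_of_padicInt {p : ℕ} [Fact p.Prime]
    (hp : (primesEquiv v₀ : ℕ) = p) (V₀ : WeierstrassCurve ℤ) {a b : ℤ_[p]}
    (hres : ((V₀.map (Int.castRingHom ℤ_[p])).map (IsLocalRing.residue ℤ_[p])).toAffine.Nonsingular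
      (IsLocalRing.residue ℤ_[p] a) (IsLocalRing.residue ℤ_[p] b))
    (hns : ((V₀.map (Int.castRingHom ℤ_[p])).baseChange ℚ_[p]).toAffine.Nonsingular
      (a : ℚ_[p]) (b : ℚ_[p]))
    (h3 : (3 : ℤ) • (Affine.Point.some _ _ hns) = 0) :
    ∃ (a₀ b₀ : v₀.adicCompletionIntegers ℚ)
      (_ : ((V₀.map (Int.castRingHom (v₀.adicCompletionIntegers ℚ))).map
          (IsLocalRing.residue (v₀.adicCompletionIntegers ℚ))).toAffine.Nonsingular
        (IsLocalRing.residue (v₀.adicCompletionIntegers ℚ) a₀)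
        (IsLocalRing.residue (v₀.adicCompletionIntegers ℚ) b₀))
      (hm : (((V₀.map (Int.castRingHom (v₀.adicCompletionIntegers ℚ))).map
          (algebraMap (v₀.adicCompletionIntegers ℚ) (v₀.adicCompletion ℚ))).baseChange
          (AlgebraicClosure (v₀.adicCompletion ℚ))).toAffine.Nonsingular
        (algebraMap (v₀.adicCompletionIntegers ℚ) (AlgebraicClosure (v₀.adicCompletion ℚ)) a₀)
        (algebraMap (v₀.adicCompletionIntegers ℚ) (AlgebraicClosure (v₀.adicCompletion ℚ)) b₀)),
      (3 : ℤ) • (Affine.Point.some _ _ hm) = 0 := by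
  subst hp
  obtain ⟨hK, h3K⟩ := exists_three_zsmul_eq_zero_padicIntEquiv_symm V₀ hns h3
  -- the coercion `𝒪_v₀ → ℚ_v₀` IS `algebraMap` (definitionally)
  obtain ⟨hm, h3m⟩ := exists_three_zsmul_eq_zero_algebraicClosure
    (R := v₀.adicCompletionIntegers ℚ) (K := v₀.adicCompletion ℚ)
    (V₀.map (Int.castRingHom (v₀.adicCompletionIntegers ℚ)))
    (a₀ := (adicCompletionIntegers.padicIntEquiv v₀).symm a)
    (b₀ := (adicCompletionIntegers.padicIntEquiv v₀).symm b) hK h3K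
  exact ⟨_, _, nonsingular_residue_padicIntEquiv_symm V₀ hres, hm, h3m⟩

/-! ### §3. The record-facing END: the `σ = E0` binders of THEOREM B from `sigmaTriCheck` -/

/-- **Σ-TRI in THEOREM B's currency.** For `W = ⟨a₁,…,a₆⟩` elliptic over `ℚ`, the place `v₀` of
`3`, and `sigmaTriCheck a₁ … a₆ = true` (`decide` per record): there are `a₀, b₀ ∈ 𝒪_v₀` with
NONSINGULAR reduction on `M = ⟨a₁,…,a₆⟩.map (Int.castRingHom 𝒪_v₀)` such that `(a₀, b₀)` is a
`3`-torsion point of `M(K̄_v₀)` — the binders `(a₀ b₀ hns₀ hm h3)` of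
`TwistedWitness.exists_sha_ne_zero_of_congr_of_identityComponent` (with `C = 1`,
`one_smul_baseChange_eq_map_intModel`). [cite: SilvermanAEC2009, VII.2 Prop. 2.1 (PDF p. 167)]
[cite: SilvermanAEC2009, Thm. IV.6.4] -/
theorem identityComponent_datum_of_sigmaTriCheck (a₁ a₂ a₃ a₄ a₆ : ℤ) (W : WeierstrassCurve ℚ)
    [W.IsElliptic] (hW : W = ⟨a₁, a₂, a₃, a₄, a₆⟩) (v₀ : HeightOneSpectrum (𝓞 ℚ))
    (hv₀ : (primesEquiv v₀ : ℕ) = 3) (h : sigmaTriCheck a₁ a₂ a₃ a₄ a₆ = true) :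
    ∃ (a₀ b₀ : v₀.adicCompletionIntegers ℚ)
      (_ : (((⟨a₁, a₂, a₃, a₄, a₆⟩ : WeierstrassCurve ℤ).map
          (Int.castRingHom (v₀.adicCompletionIntegers ℚ))).map
          (IsLocalRing.residue (v₀.adicCompletionIntegers ℚ))).toAffine.Nonsingular
        (IsLocalRing.residue (v₀.adicCompletionIntegers ℚ) a₀)
        (IsLocalRing.residue (v₀.adicCompletionIntegers ℚ) b₀))
      (hm : ((((⟨a₁, a₂, a₃, a₄, a₆⟩ : WeierstrassCurve ℤ).map
          (Int.castRingHom (v₀.adicCompletionIntegers ℚ))).map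
          (algebraMap (v₀.adicCompletionIntegers ℚ) (v₀.adicCompletion ℚ))).baseChange
          (AlgebraicClosure (v₀.adicCompletion ℚ))).toAffine.Nonsingular
        (algebraMap (v₀.adicCompletionIntegers ℚ) (AlgebraicClosure (v₀.adicCompletion ℚ)) a₀)
        (algebraMap (v₀.adicCompletionIntegers ℚ) (AlgebraicClosure (v₀.adicCompletion ℚ)) b₀)),
      (3 : ℤ) • (Affine.Point.some _ _ hm) = 0 := by
  have hΔ : (⟨a₁, a₂, a₃, a₄, a₆⟩ : WeierstrassCurve ℤ).Δ ≠ 0 := by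
    intro h0
    have hΔ' : W.Δ = (((⟨a₁, a₂, a₃, a₄, a₆⟩ : WeierstrassCurve ℤ).Δ : ℤ) : ℚ) := by
      subst hW
      rw [show (⟨(a₁ : ℚ), a₂, a₃, a₄, a₆⟩ : WeierstrassCurve ℚ) =
        (⟨a₁, a₂, a₃, a₄, a₆⟩ : WeierstrassCurve ℤ).map (Int.castRingHom ℚ) by
          ext <;> simp [WeierstrassCurve.map], WeierstrassCurve.map_Δ, eq_intCast]
    rw [h0, Int.cast_zero] at hΔ'
    exact W.isUnit_Δ.ne_zero hΔ'
  obtain ⟨a, b, hres, hns, h3⟩ :=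
    exists_nonsingular_threeTorsion_of_sigmaTriCheck a₁ a₂ a₃ a₄ a₆ hΔ h
  exact identityComponent_datum_of_padicInt hv₀ _ hres hns h3

/-! ### §4. `hcusp` at `v₀` from the `ZMod 3` identity -/

/-- **The cusp triple in THEOREM B's currency.** If `⟨a₁,…,a₆⟩ mod 3 = singularModel x̄ ȳ α α`
over `ZMod 3` (`decide` per record), then `M = ⟨a₁,…,a₆⟩.map (Int.castRingHom 𝒪_v₀)` reduces to
a `singularModel x₀ y₀ a a` over the residue field of `𝒪_v₀` (`v₀` the place of `3`) — along
`ZMod 3 ≃ ZMod p ≃ 𝔽_{ℤ_p} → 𝔽_{𝒪_v₀}` (`ZMod.ringEquivCongr`, `PadicInt.residueField`,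
`IsLocalRing.ResidueField.map`; any two ring maps out of `ℤ` agree) and part 1's
`map_singularModel`. [folklore] -/
theorem exists_map_residue_eq_singularModel_adicCompletion (a₁ a₂ a₃ a₄ a₆ : ℤ) {xc yc α : ZMod 3}
    (h : (⟨a₁, a₂, a₃, a₄, a₆⟩ : WeierstrassCurve ℤ).map (Int.castRingHom (ZMod 3)) =
      singularModel xc yc α α)
    (v₀ : HeightOneSpectrum (𝓞 ℚ)) (hv₀ : (primesEquiv v₀ : ℕ) = 3) :
    ∃ x₀ y₀ a : IsLocalRing.ResidueField (v₀.adicCompletionIntegers ℚ),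
      ((⟨a₁, a₂, a₃, a₄, a₆⟩ : WeierstrassCurve ℤ).map
          (Int.castRingHom (v₀.adicCompletionIntegers ℚ))).map
          (IsLocalRing.residue (v₀.adicCompletionIntegers ℚ)) = singularModel x₀ y₀ a a := by
  haveI : Fact (Nat.Prime (primesEquiv v₀ : ℕ)) := ⟨by rw [hv₀]; exact Nat.prime_three⟩
  -- `ZMod 3 ≃ ZMod p ≃ 𝔽_{ℤ_p} → 𝔽_{𝒪_v₀}` (`p = primesEquiv v₀ = 3`) along `padicIntEquiv`
  let ι : ZMod 3 →+* IsLocalRing.ResidueField (v₀.adicCompletionIntegers ℚ) :=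
    (IsLocalRing.ResidueField.map
      ((adicCompletionIntegers.padicIntEquiv v₀).symm :
        ℤ_[(primesEquiv v₀ : ℕ)] →+* (v₀.adicCompletionIntegers ℚ))).comp
      (((PadicInt.residueField (p := (primesEquiv v₀ : ℕ))).symm :
          ZMod (primesEquiv v₀ : ℕ) →+* IsLocalRing.ResidueField ℤ_[(primesEquiv v₀ : ℕ)]).comp
        ((ZMod.ringEquivCongr hv₀).symm : ZMod 3 →+* ZMod (primesEquiv v₀ : ℕ)))
  -- any two ring maps `ℤ → 𝔽_{𝒪_v₀}` agree
  have hcomp : (IsLocalRing.residue (v₀.adicCompletionIntegers ℚ)).comp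
      (Int.castRingHom (v₀.adicCompletionIntegers ℚ)) = ι.comp (Int.castRingHom (ZMod 3)) :=
    RingHom.ext_int _ _
  refine ⟨ι xc, ι yc, ι α, ?_⟩
  rw [WeierstrassCurve.map_map, hcomp, ← WeierstrassCurve.map_map, h, map_singularModel]

/-! ### §5. Pilot: the full per-curve binder block of THEOREM B for 2601h1 at the place of `3`
(r1 ROUTE-1 §46.5 ST-46b's suggested first row) -/

/-- 2601h1 = `[1, -1, 0, -59877, -3934008]` reduces mod `3` ON THE NOSE to `singularModel 0 0 1 1`
(`y² + xy = x³ − x²`: cusp `(0, 0)`, double tangent slope `1`; r1's triple `x̄_c = D⁻¹(0) = 0`,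
`ȳ_c ≡ a₁x̄_c + a₃ = 0`, `α ≡ a₁ = 1`). [folklore] -/
theorem cuspTriple_2601h1 :
    (⟨1, -1, 0, -59877, -3934008⟩ : WeierstrassCurve ℤ).map (Int.castRingHom (ZMod 3)) =
      singularModel 0 0 1 1 := by
  ext <;> simp [singularModel] <;> decide

/-- **The `σ = E0` binder block of 2601h1 at `3`, in THEOREM B's currency**: for any model `W`
of 2601h1 equal to `[1, -1, 0, -59877, -3934008]` and the place `v₀` of `3`, the data
`(a₀ b₀ hns₀ hm h3)` on `M = [1, -1, 0, -59877, -3934008].map (Int.castRingHom 𝒪_v₀)`.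
[folklore] -/
theorem identityComponent_datum_2601h1 (W : WeierstrassCurve ℚ) [W.IsElliptic]
    (hW : W = ⟨1, -1, 0, -59877, -3934008⟩) (v₀ : HeightOneSpectrum (𝓞 ℚ))
    (hv₀ : (primesEquiv v₀ : ℕ) = 3) :
    ∃ (a₀ b₀ : v₀.adicCompletionIntegers ℚ)
      (_ : (((⟨1, -1, 0, -59877, -3934008⟩ : WeierstrassCurve ℤ).map
          (Int.castRingHom (v₀.adicCompletionIntegers ℚ))).map
          (IsLocalRing.residue (v₀.adicCompletionIntegers ℚ))).toAffine.Nonsingular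
        (IsLocalRing.residue (v₀.adicCompletionIntegers ℚ) a₀)
        (IsLocalRing.residue (v₀.adicCompletionIntegers ℚ) b₀))
      (hm : ((((⟨1, -1, 0, -59877, -3934008⟩ : WeierstrassCurve ℤ).map
          (Int.castRingHom (v₀.adicCompletionIntegers ℚ))).map
          (algebraMap (v₀.adicCompletionIntegers ℚ) (v₀.adicCompletion ℚ))).baseChange
          (AlgebraicClosure (v₀.adicCompletion ℚ))).toAffine.Nonsingular
        (algebraMap (v₀.adicCompletionIntegers ℚ) (AlgebraicClosure (v₀.adicCompletion ℚ)) a₀)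
        (algebraMap (v₀.adicCompletionIntegers ℚ) (AlgebraicClosure (v₀.adicCompletion ℚ)) b₀)),
      (3 : ℤ) • (Affine.Point.some _ _ hm) = 0 :=
  identityComponent_datum_of_sigmaTriCheck 1 (-1) 0 (-59877) (-3934008) W hW v₀ hv₀
    sigmaTriCheck_2601h1

/-- **`hcusp` for 2601h1 at `3`**: `M mod 𝔪_v₀ = singularModel x₀ y₀ a a` for some cusp triple
over the residue field of `𝒪_v₀`. [folklore] -/
theorem exists_hcusp_2601h1 (v₀ : HeightOneSpectrum (𝓞 ℚ)) (hv₀ : (primesEquiv v₀ : ℕ) = 3) :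
    ∃ x₀ y₀ a : IsLocalRing.ResidueField (v₀.adicCompletionIntegers ℚ),
      ((⟨1, -1, 0, -59877, -3934008⟩ : WeierstrassCurve ℤ).map
          (Int.castRingHom (v₀.adicCompletionIntegers ℚ))).map
          (IsLocalRing.residue (v₀.adicCompletionIntegers ℚ)) = singularModel x₀ y₀ a a :=
  exists_map_residue_eq_singularModel_adicCompletion 1 (-1) 0 (-59877) (-3934008) cuspTriple_2601h1
    v₀ hv₀

end Summit.BirchSwinnertonDyer.Rank1Residual.GaloisImage.SigmaTri

end
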